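import Summits.QuantumFields.BalabanUV.InfraRed.StrongCouplingSixFifthsVariance
import Summits.QuantumFields.BalabanUV.InfraRed.StrongCouplingDobrushinFloor

/-!
# Strong-coupling front, J-SC15 (part 1/3): the Haar-preserving REFLECTIONS of `SU(2)` and the
symmetrisation bound for one-link covariances —
observatory of the non-perturbative crossover; no mass-gap claim

IR-3 v2 TWO-FRONT CROSSOVER LEDGER, front SC (`β₀`), SU(2), `d = 4`, Wilson normalisation `β_W = 4/g²`
(tree bare coupling `β_t = β_W/2`, 't Hooft `β_W/4`).  observatory of the non-perturbative crossover; no mass-gap claim.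

ABSOLUTE RULE. No internally-minted statement may enter as a cited fact. Every hypothesis is either
kernel-proved in this package or a verbatim quotation of a PUBLISHED theorem with page reference. The
manuscript(s) under audit are NOT citable for their own disputed steps — they are the thing under
adjudication; programme-internal (2001/route/tribunal) claims are never citable.  THIS FILE HAS NO
HYPOTHESES: every statement below is kernel-proved from Mathlib and the tree; nothing is cited (labels [folklore]).

CONTEXT.  The single-site Dobrushin door of the ledger (R12/R21, `StrongCouplingDobrushinWindow`,
`StrongCouplingDobrushinFloor`) turns a one-link Kantorovich–Rubinstein modulus `OneLinkKRModulusSU2 β_W K₂` into the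
window `18 β_W K₂ < 1`; R21 proved the floor `K₂ ≥ 1/4` (so the door ends at `β_W = 2/9`) and typed the end-point
`QuarterModulus` (`K₂ = 1/4` on the whole ball `β_W ≤ 2/9`).  The owned hypothesis-free window is `β_W < √3/9 = 0.19245`
(J-SC13, the sharp one-link Poincaré constant; a Cauchy–Schwarz route, whose one-link constant `1/√12 = 0.2887` in
vMF units cannot reach the chordal truth `1/4`).  J-SC15 (this part and parts 2/3, 3/3) supplies the TRANSPORT half of
the way to `QuarterModulus`: the coupling `(g, A_u g)` of a one-link law with itself by a Haar-preserving reflection.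

WHAT THIS FILE PROVES (all [folklore], kernel-checked):
* `reflect u hu : SU(2) → SU(2)`, `g ↦ (−u)·g⁻¹·u` for a unit quaternion `u` (embedded by the tree's `unitSU2`); in the
  quaternion chart `x_{A_u g} = −u x̄ u = x − 2⟨x,u⟩u` (`su2Quat_reflect`, `neg_mul_star_mul_eq`): the Euclidean reflection
  of `S³` in the hyperplane `u^⊥`; it moves `g` by `‖g − A_u g‖_F = 2√2 |⟨x_g, u⟩|` (`suFrobDist_reflect`, via
  `‖a − b‖_F = √2 |x_a − x_b|`, `suFrobDist_eq_sqrt_two_mul`), negates the `u`-coordinate and fixes `u^⊥`.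
* `A_u` preserves Haar measure (`integral_comp_reflect`, the tree's `integral_haar_conj_inv_eq`), hence every one-link
  law `ν_B = σ.tilted (2 Re tr(· B))` whose potential it fixes (`integral_tilted_comp_reflect`).
* SYMMETRISATION (`cov_le_of_reflect`): if `A_u` fixes `2 Re tr(· B)` and `2 Re tr(· Δ) = c ⟨x, u⟩`, then for every
  bounded measurable `φ`, `L`-Lipschitz in the Frobenius distance,
  `Cov_{ν_B}(φ, 2 Re tr(· Δ)) ≤ √2 · L · |c| · ∫ ⟨x,u⟩² dν_B`
  (`ν_B(2 Re tr(· Δ)) = 0`, `2∫ φ w = ∫ (φ − φ∘A_u) w`, `|φ − φ∘A_u| ≤ L ‖g − A_u g‖_F`).  At `B = 0` this is the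
  optimal Kantorovich plan and gives the chordal truth `1/4` of FRONT-SC §3k with equality for `φ = ⟨x, u⟩`.
Part 2/3 (`StrongCouplingTransverseMoment`) bounds `∫ ⟨x,u⟩² dν_B ≤ 1/4` for `u ⊥` the tilt axis at EVERY tilt; part 3/3
(`StrongCouplingQuarterCovariance`) states the covariance form `QuarterCovariance` of `QuarterModulus`, proves
`QuarterCovariance → QuarterModulus` and the transverse case for every `B`, and records the doors to `β_W < 2/9`.

NOT CLAIMED: `QuarterModulus` / `QuarterCovariance` themselves (the OBLIQUE directions at `B ≠ 0` remain open; the owned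
number of the ledger does not move in J-SC15); nothing about `N ≥ 3`; no mass-gap claim.
-/

noncomputable section

open MeasureTheory Filter Topology ProbabilityTheory Finset Real
open scoped NNReal Quaternion
open Literature.Probability.LatticeModels
open Literature.MathematicalPhysics.QuantumLattice (fundamentalRep fundamentalLatticeRep quatMatrix su2Quat quatToSU2)
open Literature.MathematicalPhysics.QuantumFieldTheory
open Literature.MathematicalPhysics.QuantumFieldTheory.Balaban1983to89
open Literature.MathematicalPhysics.QuantumFieldTheory.Balaban1983to89.StrongCouplingDobrushinWindow
open Literature.MathematicalPhysics.QuantumFieldTheory.Balaban1983to89.StrongCouplingTorusWindow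
open Literature.MathematicalPhysics.QuantumFieldTheory.Balaban1983to89.StrongCouplingKernelWindow
open Literature.MathematicalPhysics.QuantumFieldTheory.Balaban1983to89.StrongCouplingOpenWindow
open Literature.MathematicalPhysics.QuantumFieldTheory.Balaban1983to89.StrongCouplingVarianceWindow
open Summit.QuantumFields.BalabanUV.InfraRed.StrongCouplingSixFifthsVariance

namespace Summit.QuantumFields.BalabanUV.InfraRed.StrongCouplingReflection

local notation "SU2" => Matrix.specialUnitaryGroup (Fin 2) ℂ
local notation "M₂" => Matrix (Fin 2) (Fin 2) ℂ
local notation "σ₂" => haarProbability (Matrix.specialUnitaryGroup (Fin 2) ℂ)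

/-! ## Part A: the reflections of `SU(2)` in the quaternion chart -/

/-- Inversion is quaternionic conjugation: `su2Quat g⁻¹ = star (su2Quat g)`. [folklore] -/
private theorem su2Quat_inv' (g : SU2) : su2Quat g⁻¹ = star (su2Quat g) := by
  have h : ((g⁻¹ : SU2) : M₂) = star (g : M₂) := rfl
  have h10 := Literature.MathematicalPhysics.QuantumLattice.su2_apply_10 g
  ext <;> simp [su2Quat, h, Matrix.star_apply, h10]

/-- A unit quaternion has unit negative. [folklore] -/
private theorem norm_neg_eq_one {u : ℍ} (hu : ‖u‖ = 1) : ‖-u‖ = 1 := by rw [norm_neg, hu]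

/-- **The reflection of `SU(2)` attached to a unit quaternion `u`**: `g ↦ (−u) · g⁻¹ · u`, i.e. in the quaternion
chart `x ↦ −u x̄ u`, the Euclidean reflection of `S³ ⊂ ℝ⁴` in the hyperplane `u^⊥`. [folklore] -/
def reflect (u : ℍ) (hu : ‖u‖ = 1) (g : SU2) : SU2 :=
  unitSU2 (-u) (norm_neg_eq_one hu) * g⁻¹ * unitSU2 u hu

/-- The reflection in the chart: `x_{A_u g} = −u · x̄_g · u`. [folklore] -/
theorem su2Quat_reflect (u : ℍ) (hu : ‖u‖ = 1) (g : SU2) :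
    su2Quat (reflect u hu g) = -u * star (su2Quat g) * u := by
  rw [reflect, su2Quat_mul, su2Quat_mul, su2Quat_unitSU2, su2Quat_unitSU2, su2Quat_inv']

/-- The squared-norm identity `u₀² + u₁² + u₂² + u₃² = 1` of a unit quaternion. [folklore] -/
private theorem sq_sum_of_norm_eq_one {u : ℍ} (hu : ‖u‖ = 1) :
    u.re ^ 2 + u.imI ^ 2 + u.imJ ^ 2 + u.imK ^ 2 = 1 := by
  have h := Quaternion.normSq_eq_norm_mul_self u
  rw [hu, mul_one, Quaternion.normSq_def'] at h
  exact h

/-- **The reflection formula**: `−u x̄ u = x − 2⟨x, u⟩ u` with `⟨x, u⟩ = Re(x ū)`, for a unit quaternion `u`.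
[folklore] -/
theorem neg_mul_star_mul_eq (x : ℍ) {u : ℍ} (hu : ‖u‖ = 1) :
    -u * star x * u = x - (2 * (x * star u).re) • u := by
  have h := sq_sum_of_norm_eq_one hu
  ext <;> simp only [Quaternion.re_mul, Quaternion.imI_mul, Quaternion.imJ_mul, Quaternion.imK_mul,
    Quaternion.re_neg, Quaternion.imI_neg, Quaternion.imJ_neg, Quaternion.imK_neg, Quaternion.re_star,
    Quaternion.imI_star, Quaternion.imJ_star, Quaternion.imK_star, Quaternion.re_sub, Quaternion.imI_sub,
    Quaternion.imJ_sub, Quaternion.imK_sub, Quaternion.re_smul, Quaternion.imI_smul, Quaternion.imJ_smul,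
    Quaternion.imK_smul, smul_eq_mul] <;> first
    | linear_combination x.re * h
    | linear_combination x.imI * h
    | linear_combination x.imJ * h
    | linear_combination x.imK * h


/-- The Euclidean pairing of the chart: `Re(x ȳ) = x₀y₀ + x₁y₁ + x₂y₂ + x₃y₃`. [folklore] -/
theorem re_mul_star (x y : ℍ) :
    (x * star y).re = x.re * y.re + x.imI * y.imI + x.imJ * y.imJ + x.imK * y.imK := by
  simp only [Quaternion.re_mul, Quaternion.re_star, Quaternion.imI_star, Quaternion.imJ_star, Quaternion.imK_star]
  ring

/-- **Displacement of the reflection**: `‖x − (−u x̄ u)‖ = 2 |⟨x, u⟩|`. [folklore] -/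
theorem norm_sub_reflect (x : ℍ) {u : ℍ} (hu : ‖u‖ = 1) :
    ‖x - (-u * star x * u)‖ = 2 * |(x * star u).re| := by
  rw [neg_mul_star_mul_eq x hu, sub_sub_cancel, norm_smul, hu, mul_one, Real.norm_eq_abs, abs_mul, abs_two]

/-- The reflection negates the `u`-coordinate: `⟨−u x̄ u, u⟩ = −⟨x, u⟩`. [folklore] -/
theorem re_reflect_mul_star_self (x : ℍ) {u : ℍ} (hu : ‖u‖ = 1) :
    (-u * star x * u * star u).re = -(x * star u).re := by
  have h1 : (u * star u).re = 1 := by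
    rw [re_mul_star]; have h := sq_sum_of_norm_eq_one hu; nlinarith [h]
  rw [neg_mul_star_mul_eq x hu, sub_mul, smul_mul_assoc, Quaternion.re_sub, Quaternion.re_smul, smul_eq_mul, h1]
  ring

/-- The reflection fixes every coordinate orthogonal to `u`: if `Re(u b) = 0` then `Re((−u x̄ u) b) = Re(x b)`.
[folklore] -/
theorem re_reflect_mul_of_orth (x : ℍ) {u b : ℍ} (hu : ‖u‖ = 1) (hb : (u * b).re = 0) :
    (-u * star x * u * b).re = (x * b).re := by
  rw [neg_mul_star_mul_eq x hu, sub_mul, smul_mul_assoc, Quaternion.re_sub, Quaternion.re_smul, smul_eq_mul, hb]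
  ring

/-- **The Frobenius distance of `SU(2)` in the chart**: `‖a − b‖_F = √2 · ‖x_a − x_b‖`. [folklore] -/
theorem suFrobDist_eq_sqrt_two_mul (a b : SU2) : suFrobDist a b = Real.sqrt 2 * ‖su2Quat a - su2Quat b‖ := by
  have ha10 := Literature.MathematicalPhysics.QuantumLattice.su2_apply_10 a
  have ha11 := Literature.MathematicalPhysics.QuantumLattice.su2_apply_11 a
  have hb10 := Literature.MathematicalPhysics.QuantumLattice.su2_apply_10 b
  have hb11 := Literature.MathematicalPhysics.QuantumLattice.su2_apply_11 b
  have hq : ‖su2Quat a - su2Quat b‖ ^ 2 =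
      ((su2Quat a).re - (su2Quat b).re) ^ 2 + ((su2Quat a).imI - (su2Quat b).imI) ^ 2 +
        ((su2Quat a).imJ - (su2Quat b).imJ) ^ 2 + ((su2Quat a).imK - (su2Quat b).imK) ^ 2 := by
    have h := Quaternion.normSq_eq_norm_mul_self (su2Quat a - su2Quat b)
    rw [Quaternion.normSq_def', Quaternion.re_sub, Quaternion.imI_sub, Quaternion.imJ_sub, Quaternion.imK_sub] at h
    rw [sq, ← h]
  have hF : suFrobDist a b ^ 2 = 2 * ‖su2Quat a - su2Quat b‖ ^ 2 := by
    rw [hq, suFrobDist, frobNorm_sq, Fin.sum_univ_two, Fin.sum_univ_two, Fin.sum_univ_two]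
    simp only [Matrix.sub_apply, ha10, ha11, hb10, hb11, Complex.sq_norm, Complex.normSq_apply, Complex.sub_re,
      Complex.sub_im, Complex.neg_re, Complex.neg_im, Complex.conj_re, Complex.conj_im, su2Quat]
    ring
  have h2 : (Real.sqrt 2 * ‖su2Quat a - su2Quat b‖) ^ 2 = 2 * ‖su2Quat a - su2Quat b‖ ^ 2 := by
    rw [mul_pow, Real.sq_sqrt (by norm_num : (0:ℝ) ≤ 2)]
  have := (sq_eq_sq₀ (suFrobDist_nonneg a b) (by positivity)).1 (hF.trans h2.symm)
  exact this

/-- The displacement of `g` under the reflection, in the Frobenius distance: `‖g − A_u g‖_F = 2√2 |⟨x_g, u⟩|`.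
[folklore] -/
theorem suFrobDist_reflect (u : ℍ) (hu : ‖u‖ = 1) (g : SU2) :
    suFrobDist g (reflect u hu g) = 2 * Real.sqrt 2 * |(su2Quat g * star u).re| := by
  rw [suFrobDist_eq_sqrt_two_mul, su2Quat_reflect, norm_sub_reflect _ hu]
  ring

/-- The reflection is continuous. [folklore] -/
theorem continuous_reflect (u : ℍ) (hu : ‖u‖ = 1) : Continuous (reflect u hu) := by
  have h1 : Continuous fun g : SU2 => g⁻¹ := continuous_inv
  exact (continuous_const.mul h1).mul continuous_const

/-- The `u`-coordinate `g ↦ ⟨x_g, u⟩` is continuous. [folklore] -/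
theorem continuous_re_mul_star (u : ℍ) : Continuous fun s : SU2 => (su2Quat s * star u).re := by
  have h00 : Continuous fun g : SU2 => (g : M₂) 0 0 := (continuous_apply_apply 0 0).comp continuous_subtype_val
  have h01 : Continuous fun g : SU2 => (g : M₂) 0 1 := (continuous_apply_apply 0 1).comp continuous_subtype_val
  have hre : Continuous fun g : SU2 => (su2Quat g).re := Complex.continuous_re.comp h00
  have himI : Continuous fun g : SU2 => (su2Quat g).imI := Complex.continuous_im.comp h00
  have himJ : Continuous fun g : SU2 => (su2Quat g).imJ := Complex.continuous_re.comp h01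
  have himK : Continuous fun g : SU2 => (su2Quat g).imK := Complex.continuous_im.comp h01
  simp only [re_mul_star]
  exact (((hre.mul continuous_const).add (himI.mul continuous_const)).add (himJ.mul continuous_const)).add
    (himK.mul continuous_const)

/-- `⟨x, u⟩² ≤ 1` on the sphere (Cauchy–Schwarz with `|x| = |u| = 1`). [folklore] -/
theorem re_mul_star_sq_le_one (s : SU2) {u : ℍ} (hu : ‖u‖ = 1) : (su2Quat s * star u).re ^ 2 ≤ 1 := by
  rw [re_mul_star]
  have h1 := sq_sum_su2Quat s
  have h2 := sq_sum_of_norm_eq_one hu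
  nlinarith [sq_nonneg ((su2Quat s).re * u.imI - (su2Quat s).imI * u.re),
    sq_nonneg ((su2Quat s).re * u.imJ - (su2Quat s).imJ * u.re), sq_nonneg ((su2Quat s).re * u.imK - (su2Quat s).imK * u.re),
    sq_nonneg ((su2Quat s).imI * u.imJ - (su2Quat s).imJ * u.imI), sq_nonneg ((su2Quat s).imI * u.imK - (su2Quat s).imK * u.imI),
    sq_nonneg ((su2Quat s).imJ * u.imK - (su2Quat s).imK * u.imJ)]

/-! ## Part B: the reflections preserve Haar measure, and the one-link laws they fix -/

/-- **Haar invariance**: `∫ H(A_u g) dσ(g) = ∫ H(g) dσ(g)` (inverse, left and right invariance of the Haar probability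
measure of the compact group `SU(2)`). [folklore] -/
theorem integral_comp_reflect (u : ℍ) (hu : ‖u‖ = 1) (H : SU2 → ℝ) :
    ∫ g, H (reflect u hu g) ∂σ₂ = ∫ g, H g ∂σ₂ :=
  integral_haar_conj_inv_eq H _ _

/-- The normalisation `σ(e^{pot B})` is the integral of a continuous function: integrable. [folklore] -/
theorem integrable_exp_pot (B : M₂) : Integrable (fun s : SU2 => exp (pot B s)) σ₂ :=
  (continuous_exp.comp (continuous_pot B)).integrable_of_hasCompactSupport (HasCompactSupport.of_compactSpace _)

/-- **Invariance of the one-link law**: if the potential is fixed by the reflection (`pot B ∘ A_u = pot B`), then so is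
the one-link law `ν_B = σ.tilted (pot B)`: `∫ H(A_u g) dν_B = ∫ H dν_B`. [folklore] -/
theorem integral_tilted_comp_reflect {u : ℍ} (hu : ‖u‖ = 1) {B : M₂} (hB : ∀ g, pot B (reflect u hu g) = pot B g)
    (H : SU2 → ℝ) :
    ∫ g, H (reflect u hu g) ∂((σ₂).tilted (pot B)) = ∫ g, H g ∂((σ₂).tilted (pot B)) := by
  rw [integral_tilted, integral_tilted]
  have h := integral_comp_reflect u hu (fun g => (exp (pot B g) / ∫ x, exp (pot B x) ∂σ₂) • H g)
  simp only [hB] at h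
  exact h

/-! ## Part C: the symmetrisation bound for the covariance -/

/-- **Symmetrisation.**  Let the reflection `A_u` fix `pot B` and let the observable be the `u`-coordinate,
`pot Δ = c · ⟨x, u⟩` (so that `pot Δ ∘ A_u = −pot Δ`).  Then for every bounded measurable `φ` that is `L`-Lipschitz for
the Frobenius distance, `Cov_{ν_B}(φ, pot Δ) ≤ √2 · L · |c| · ∫ ⟨x, u⟩² dν_B`: indeed `ν_B(pot Δ) = 0`,
`2 ∫ φ · pot Δ dν_B = ∫ (φ − φ ∘ A_u) · pot Δ dν_B` and `|φ − φ ∘ A_u| ≤ L ‖g − A_u g‖_F = 2√2 L |⟨x, u⟩|`.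
(The coupling `(g, A_u g)` of `ν_B` with itself; at `B = 0` it is the optimal Kantorovich plan.) [folklore] -/
theorem cov_le_of_reflect {u : ℍ} (hu : ‖u‖ = 1) {B Δ : M₂} {c : ℝ} (hB : ∀ g, pot B (reflect u hu g) = pot B g)
    (hΔ : ∀ g, pot Δ g = c * (su2Quat g * star u).re) {φ : SU2 → ℝ} {L : ℝ} (hφm : Measurable φ)
    (hφb : ∃ C, ∀ s, |φ s| ≤ C) (hφL : ∀ a b, |φ a - φ b| ≤ L * suFrobDist a b) :
    ∫ s, φ s * pot Δ s ∂((σ₂).tilted (pot B)) -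
        (∫ s, φ s ∂((σ₂).tilted (pot B))) * (∫ s, pot Δ s ∂((σ₂).tilted (pot B))) ≤
      Real.sqrt 2 * L * |c| * ∫ s, (su2Quat s * star u).re ^ 2 ∂((σ₂).tilted (pot B)) := by
  obtain ⟨C, hC⟩ := hφb
  set ν : Measure SU2 := (σ₂).tilted (pot B) with hν
  haveI : IsProbabilityMeasure ν := isProbabilityMeasure_tilted (integrable_exp_pot B)
  have hA : ∀ g, pot Δ (reflect u hu g) = -pot Δ g := fun g => by
    rw [hΔ, hΔ, su2Quat_reflect, re_reflect_mul_star_self _ hu]; ring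
  -- integrability
  have hpm : Measurable (pot Δ) := (continuous_pot Δ).measurable
  have hpb : ∀ s, |pot Δ s| ≤ 2 * (Real.sqrt 2 * frobNorm Δ) := abs_pot_le Δ
  have hφi : Integrable φ ν := integrable_of_measurable_of_abs_le hφm hC
  have hφAm : Measurable fun s => φ (reflect u hu s) := hφm.comp (continuous_reflect u hu).measurable
  have hφpi : Integrable (fun s => φ s * pot Δ s) ν :=
    integrable_of_measurable_of_abs_le (hφm.mul hpm) (C := C * (2 * (Real.sqrt 2 * frobNorm Δ))) fun s => by
      rw [abs_mul]; exact mul_le_mul (hC s) (hpb s) (abs_nonneg _) ((abs_nonneg _).trans (hC s))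
  have hφApi : Integrable (fun s => φ (reflect u hu s) * pot Δ s) ν :=
    integrable_of_measurable_of_abs_le (hφAm.mul hpm) (C := C * (2 * (Real.sqrt 2 * frobNorm Δ))) fun s => by
      rw [abs_mul]
      exact mul_le_mul (hC (reflect u hu s)) (hpb s) (abs_nonneg _) ((abs_nonneg _).trans (hC (reflect u hu s)))
  have hu2i : Integrable (fun s : SU2 => (su2Quat s * star u).re ^ 2) ν :=
    integrable_of_measurable_of_abs_le ((continuous_re_mul_star u).pow 2).measurable (C := 1) fun s => by
      rw [abs_of_nonneg (sq_nonneg _)]; exact re_mul_star_sq_le_one s hu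
  -- the mean of the odd observable vanishes
  have h0 : ∫ s, pot Δ s ∂ν = 0 := by
    have h := integral_tilted_comp_reflect hu hB (pot Δ)
    simp only [hA] at h
    rw [integral_neg] at h
    linarith
  -- symmetrisation
  have h1 : ∫ s, φ s * pot Δ s ∂ν = -∫ s, φ (reflect u hu s) * pot Δ s ∂ν := by
    have h := integral_tilted_comp_reflect hu hB (fun s => φ s * pot Δ s)
    simp only [hA, mul_neg] at h
    rw [integral_neg] at h
    linarith
  have h2 : 2 * ∫ s, φ s * pot Δ s ∂ν = ∫ s, (φ s - φ (reflect u hu s)) * pot Δ s ∂ν := by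
    have : ∫ s, (φ s - φ (reflect u hu s)) * pot Δ s ∂ν =
        ∫ s, φ s * pot Δ s ∂ν - ∫ s, φ (reflect u hu s) * pot Δ s ∂ν := by
      rw [← integral_sub hφpi hφApi]
      refine integral_congr_ae (ae_of_all _ fun s => ?_)
      ring
    rw [this]; linarith
  -- the pointwise Lipschitz bound along the coupling `(g, A_u g)`
  have hfi : Integrable (fun s => (φ s - φ (reflect u hu s)) * pot Δ s) ν := by
    refine (hφpi.sub hφApi).congr (ae_of_all _ fun s => ?_)
    simp only [Pi.sub_apply]
    ring
  have h3 : ∫ s, (φ s - φ (reflect u hu s)) * pot Δ s ∂ν ≤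
      ∫ s, (2 * Real.sqrt 2 * L * |c|) * (su2Quat s * star u).re ^ 2 ∂ν := by
    refine integral_mono hfi (hu2i.const_mul _) fun s => ?_
    have hl := hφL s (reflect u hu s)
    rw [suFrobDist_reflect u hu] at hl
    have h4 : (φ s - φ (reflect u hu s)) * pot Δ s ≤ |φ s - φ (reflect u hu s)| * |pot Δ s| := by
      rw [← abs_mul]; exact le_abs_self _
    refine h4.trans ?_
    have ha : 0 ≤ |(su2Quat s * star u).re| := abs_nonneg _
    have hb : 0 ≤ |c| := abs_nonneg _
    calc |φ s - φ (reflect u hu s)| * |pot Δ s|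
        ≤ L * (2 * Real.sqrt 2 * |(su2Quat s * star u).re|) * (|c| * |(su2Quat s * star u).re|) := by
          rw [hΔ, abs_mul]; exact mul_le_mul_of_nonneg_right hl (mul_nonneg hb ha)
      _ = 2 * Real.sqrt 2 * L * |c| * |(su2Quat s * star u).re| ^ 2 := by ring
      _ = 2 * Real.sqrt 2 * L * |c| * (su2Quat s * star u).re ^ 2 := by rw [sq_abs]
  rw [h0, mul_zero, sub_zero]
  rw [integral_const_mul] at h3
  nlinarith [h2, h3]


end Summit.QuantumFields.BalabanUV.InfraRed.StrongCouplingReflection
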